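/-
  SoloInformedProductCurrency.lean — solo-ABC-informed, session 13 (2026-08-19).

  THEOREM G (paper §2.2 (ii), claim C11 (ii); was a prose remark since session 3, now kernel).
  PRODUCT-CURRENCY INVARIANCE OF THE RESIDUE-TORSION FACTOR.

  Setting.  `p` is a prime, `u₀, …, u_{n-1} ∈ (ℤ/p)ˣ` are the residues of the generators
  `q₀, …, q_{n-1}` of a linear form in `p`-adic logarithms (in the abc application: the primes of
  `ab` at a prime `p ∣ c`), `G_p = ⟨u_i⟩ ≤ (ℤ/p)ˣ` is cyclic, generated by some `γ` of order
  `g = |G_p|`, and `u_i = γ ^ d_i` (discrete logarithms).  Every proved `p`-adic bound for a linear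
  form in the logarithms of NON-principal units carries a factor of the size of `g` (Yu's `N℘/δ`,
  Bugeaud–Laurent's `g`; paper §2.2 (i), (v)); for PRINCIPAL units (`≡ 1 (mod p)`) it does not.
  The obvious dodge is to re-choose the generators as principal units
  `η_j = ∏_i q_i ^ (v j i)` (`j < n`), i.e. `∏_i u_i ^ (v j i) = 1` in `(ℤ/p)ˣ`, at the cost of
  their heights `h(η_j) ≥ ‖v j‖_∞ · log 2`.  THEOREM G: for any `n` such rows whose exponent
  matrix is non-singular (⇔ the `η_j` are multiplicatively independent when the `q_i` are),

        (log 2)^n · g ≤ n! · ∏_j h_j        whenever  h_j ≥ |v j i| · log 2  for all `i`,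

  so in every estimate that is MULTIPLICATIVE in the heights of the generators the factor `g`
  re-appears in full, up to `n!/(log 2)^n` and the (small) heights of the original generators:
  the residue-torsion factor (B-i) is the covolume of the relation lattice, a quantity of the pair
  (linear form, prime), and cannot be removed by choosing generators cleverly.  (With `≡ ±1`
  instead of `≡ 1` the index changes by a factor ≤ 2; the theorem is stated for `≡ 1`.)

  Proof (three elementary steps, all below):
  (1) `soloInformed_orderOf_dvd_row`: a principal-unit row has `g ∣ ∑_i v j i · d_i`
      (because `γ ^ (∑ v j i d_i) = ∏ u_i ^ (v j i) = 1`);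
      `soloInformed_bezout_of_generator`: if `γ` itself is a product of powers of the `u_i`
      (i.e. `γ ∈ G_p`), then `∑ c_i d_i + c₀ g = 1` for some integers `c_i, c₀`.
  (2) `soloInformed_dvd_det_of_rows`: if every row of `V ∈ M_n(ℤ)` satisfies `g ∣ (V d)_j` and
      `∑ c_i d_i + c₀ g = 1`, then `g ∣ det V` (multiply `V d ≡ 0` by the adjugate:
      `det V · d ≡ 0 (mod g)`, then use Bézout) — the INDEX step: the rows lie in a lattice of
      index `g`, so `g` divides their determinant.
  (3) `soloInformed_abs_det_le_factorial_mul_prod`: `|det W| ≤ n! · ∏_j B_j` whenever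
      `|W j i| ≤ B_j` (Leibniz expansion; Hadamard would give `n^{n/2}`), over `ℝ`.
  Assembly: `soloInformed_productCurrency` (abstract rows),
  `soloInformed_productCurrency_units` (rows of principal units, explicit generator `γ`) and
  `soloInformed_productCurrency_closure` (intrinsic: `g = |⟨u_i⟩|` in any commutative cyclic
  group, e.g. `(ZMod p)ˣ`; the case `n = 2` of the index step is session 8's
  `soloInformed_card_closure_dvd_det` in `SoloInformedRelationLattice.lean`);
  `soloInformed_log_two_mul_abs_le_log_max` certifies that the naive height
  `log max(∏ q_i^{(v_i)⁺}, ∏ q_i^{(v_i)⁻})` of `η = ∏ q_i^{v_i}` (`q_i ≥ 2`) satisfies the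
  hypothesis `h ≥ |v_i| log 2`, and `soloInformed_coprime_num_den` that this fraction is reduced
  when the `q_i` are pairwise coprime (so it IS the logarithmic height of `η`).

  Scope, honestly: a theorem about integer matrices, cyclic groups and products of numbers ≥ 2;
  it formalises the sentence "(B-i) is invariant under change of generators in the product
  currency" of the sharpest-statement report and says nothing about abc itself.
  Mathlib only; standard axioms.
-/
import Mathlib

open Finset Matrix

namespace Summit.ABC.ABC.Theorems

/-! ### Step 3: Leibniz bound for a determinant, row by row -/

/-- `|det W| ≤ n! · ∏_j B_j` when row `j` of `W` is bounded by `B_j` in sup-norm. -/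
theorem soloInformed_abs_det_le_factorial_mul_prod {n : ℕ} (W : Matrix (Fin n) (Fin n) ℝ)
    (B : Fin n → ℝ) (hB : ∀ j i, |W j i| ≤ B j) :
    |W.det| ≤ (n.factorial : ℝ) * ∏ j, B j := by
  rw [Matrix.det_apply']
  calc |∑ σ : Equiv.Perm (Fin n), ((Equiv.Perm.sign σ : ℤ) : ℝ) * ∏ i, W (σ i) i|
      ≤ ∑ σ : Equiv.Perm (Fin n), |((Equiv.Perm.sign σ : ℤ) : ℝ) * ∏ i, W (σ i) i| :=
        Finset.abs_sum_le_sum_abs _ _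
    _ ≤ ∑ _σ : Equiv.Perm (Fin n), ∏ j, B j := by
        refine Finset.sum_le_sum fun σ _ => ?_
        have hsign : |((Equiv.Perm.sign σ : ℤ) : ℝ)| = 1 := by
          rcases Int.units_eq_one_or (Equiv.Perm.sign σ) with h | h <;> simp [h]
        rw [abs_mul, hsign, one_mul, Finset.abs_prod]
        calc ∏ i, |W (σ i) i| ≤ ∏ i, B (σ i) :=
              Finset.prod_le_prod (fun i _ => abs_nonneg _) (fun i _ => hB (σ i) i)
          _ = ∏ j, B j := Fintype.prod_equiv σ (fun i => B (σ i)) B (fun _ => rfl)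
    _ = (n.factorial : ℝ) * ∏ j, B j := by
        rw [Finset.sum_const, Finset.card_univ, Fintype.card_perm, Fintype.card_fin, nsmul_eq_mul]

/-! ### Step 2: the index step — rows in a lattice of index `g` have determinant divisible by `g` -/

/-- If every row `V j` satisfies `g ∣ ∑_i V j i · d_i` and the `d_i` generate `ℤ/g`
(Bézout form `∑ c_i d_i + c₀ g = 1`), then `g ∣ det V`. -/
theorem soloInformed_dvd_det_of_rows {n : ℕ} (g : ℤ) (d : Fin n → ℤ)
    (hgen : ∃ c : Fin n → ℤ, ∃ c₀ : ℤ, ∑ i, c i * d i + c₀ * g = 1)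
    (V : Matrix (Fin n) (Fin n) ℤ) (hV : ∀ j, g ∣ ∑ i, V j i * d i) :
    g ∣ V.det := by
  obtain ⟨c, c₀, hc⟩ := hgen
  -- `V *ᵥ d ≡ 0 (mod g)` componentwise
  have hVd : ∀ j, g ∣ (V *ᵥ d) j := fun j => by
    simpa [Matrix.mulVec, dotProduct] using hV j
  -- multiply by the adjugate: `det V • d = adj V *ᵥ (V *ᵥ d)`
  have hkey : ∀ i, g ∣ V.det * d i := by
    intro i
    have h1 : (V.adjugate *ᵥ (V *ᵥ d)) i = V.det * d i := by
      rw [Matrix.mulVec_mulVec, Matrix.adjugate_mul, Matrix.smul_mulVec, Matrix.one_mulVec]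
      simp [Pi.smul_apply]
    rw [← h1]
    simp only [Matrix.mulVec, dotProduct]
    exact Finset.dvd_sum fun j _ => Dvd.dvd.mul_left (hVd j) _
  -- Bézout: `det V = det V · (∑ c_i d_i + c₀ g)`
  have : V.det = ∑ i, c i * (V.det * d i) + (V.det * c₀) * g := by
    calc V.det = V.det * (∑ i, c i * d i + c₀ * g) := by rw [hc, mul_one]
      _ = ∑ i, c i * (V.det * d i) + (V.det * c₀) * g := by
          rw [mul_add, Finset.mul_sum]
          congr 1
          · exact Finset.sum_congr rfl fun i _ => by ring
          · ring
  rw [this]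
  exact dvd_add (Finset.dvd_sum fun i _ => Dvd.dvd.mul_left (hkey i) _) (Dvd.intro_left _ rfl)

/-! ### Step 1: principal-unit rows and the generator, in a cyclic group -/

/-- `∏_i γ ^ e_i = γ ^ ∑_i e_i` (integer exponents). -/
theorem soloInformed_prod_zpow_eq_zpow_sum {G : Type*} [CommGroup G] {ι : Type*} (γ : G)
    (e : ι → ℤ) (s : Finset ι) : ∏ i ∈ s, γ ^ e i = γ ^ ∑ i ∈ s, e i := by
  classical
  induction s using Finset.induction_on with
  | empty => simp
  | insert a s ha ih => rw [Finset.prod_insert ha, Finset.sum_insert ha, _root_.zpow_add, ih]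

/-- A PRINCIPAL-UNIT ROW: if `u_i = γ ^ d_i` and `∏_i u_i ^ v_i = 1`, then
`orderOf γ ∣ ∑_i v_i d_i`. -/
theorem soloInformed_orderOf_dvd_row {G : Type*} [CommGroup G] {n : ℕ} (u : Fin n → G) (γ : G)
    (d : Fin n → ℤ) (hd : ∀ i, u i = γ ^ d i) (v : Fin n → ℤ) (hv : ∏ i, u i ^ v i = 1) :
    (orderOf γ : ℤ) ∣ ∑ i, v i * d i := by
  rw [orderOf_dvd_iff_zpow_eq_one, ← soloInformed_prod_zpow_eq_zpow_sum]
  rw [← hv]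
  refine Finset.prod_congr rfl fun i _ => ?_
  rw [hd i, ← _root_.zpow_mul, mul_comm]

/-- THE GENERATOR: if `u_i = γ ^ d_i` and `γ` is itself a product of powers of the `u_i`
(i.e. `γ ∈ ⟨u_i⟩`, so that `⟨u_i⟩ = ⟨γ⟩` has order `orderOf γ`), then the `d_i` generate
`ℤ/orderOf γ`: `∑ c_i d_i + c₀ · orderOf γ = 1` for some integers. -/
theorem soloInformed_bezout_of_generator {G : Type*} [CommGroup G] {n : ℕ} (u : Fin n → G)
    (γ : G) (d : Fin n → ℤ) (hd : ∀ i, u i = γ ^ d i)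
    (hγ : ∃ c : Fin n → ℤ, γ = ∏ i, u i ^ c i) :
    ∃ c : Fin n → ℤ, ∃ c₀ : ℤ, ∑ i, c i * d i + c₀ * (orderOf γ : ℤ) = 1 := by
  obtain ⟨c, hc⟩ := hγ
  have h1 : γ ^ (∑ i, c i * d i - 1) = 1 := by
    rw [_root_.zpow_sub, zpow_one, ← soloInformed_prod_zpow_eq_zpow_sum]
    have : ∏ i, γ ^ (c i * d i) = γ :=
      calc ∏ i, γ ^ (c i * d i) = ∏ i, u i ^ c i :=
            Finset.prod_congr rfl fun i _ => by rw [hd i, ← _root_.zpow_mul, mul_comm]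
        _ = γ := hc.symm
    rw [this, mul_inv_cancel]
  obtain ⟨k, hk⟩ := (orderOf_dvd_iff_zpow_eq_one).mpr h1
  refine ⟨c, -k, ?_⟩
  linear_combination hk

/-! ### Assembly -/

/-- THEOREM G, abstract rows.  If the `d_i` generate `ℤ/g` (Bézout form), every row of
the non-singular integer matrix `V` lies in the relation lattice `{x : g ∣ ∑ x_i d_i}`, and
`h_j ≥ |V j i| · log 2` for all `j, i`, then `(log 2)^n · g ≤ n! · ∏_j h_j`. -/
theorem soloInformed_productCurrency {n : ℕ} (g : ℕ) (d : Fin n → ℤ)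
    (hgen : ∃ c : Fin n → ℤ, ∃ c₀ : ℤ, ∑ i, c i * d i + c₀ * (g : ℤ) = 1)
    (V : Matrix (Fin n) (Fin n) ℤ) (hV : ∀ j, (g : ℤ) ∣ ∑ i, V j i * d i) (hdet : V.det ≠ 0)
    (h : Fin n → ℝ) (hh : ∀ j i, (|V j i| : ℝ) * Real.log 2 ≤ h j) :
    (Real.log 2) ^ n * (g : ℝ) ≤ (n.factorial : ℝ) * ∏ j, h j := by
  have hlog2 : 0 < Real.log 2 := Real.log_pos one_lt_two
  -- index step: g ≤ |det V|
  have hgdvd : (g : ℤ) ∣ V.det := soloInformed_dvd_det_of_rows (g : ℤ) d hgen V hV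
  have hgle : (g : ℤ) ≤ |V.det| := Int.le_of_dvd (abs_pos.mpr hdet) ((dvd_abs _ _).mpr hgdvd)
  have hgleR : (g : ℝ) ≤ |(V.det : ℝ)| := by
    have := (Int.cast_le (R := ℝ)).mpr hgle
    simpa [Int.cast_abs] using this
  -- Leibniz step on the real matrix
  set W : Matrix (Fin n) (Fin n) ℝ := V.map (fun x => (x : ℝ)) with hW
  have hWdet : (V.det : ℝ) = W.det := by rw [hW, Int.cast_det]
  have hWB : ∀ j i, |W j i| ≤ h j / Real.log 2 := by
    intro j i
    rw [le_div_iff₀ hlog2]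
    simpa [hW, Matrix.map_apply, Int.cast_abs] using hh j i
  have hLeib := soloInformed_abs_det_le_factorial_mul_prod W (fun j => h j / Real.log 2) hWB
  have hprod : ∏ j, h j / Real.log 2 = (∏ j, h j) / (Real.log 2) ^ n := by
    rw [Finset.prod_div_distrib, Finset.prod_const, Finset.card_univ, Fintype.card_fin]
  rw [hprod] at hLeib
  have hlogn : 0 < (Real.log 2) ^ n := pow_pos hlog2 n
  -- combine
  have : (g : ℝ) ≤ (n.factorial : ℝ) * ((∏ j, h j) / (Real.log 2) ^ n) :=
    hgleR.trans (hWdet ▸ hLeib)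
  calc (Real.log 2) ^ n * (g : ℝ)
      ≤ (Real.log 2) ^ n * ((n.factorial : ℝ) * ((∏ j, h j) / (Real.log 2) ^ n)) :=
        mul_le_mul_of_nonneg_left this hlogn.le
    _ = (n.factorial : ℝ) * ∏ j, h j := by
        field_simp

/-- THEOREM G for PRINCIPAL UNITS.  Let `u_i = γ ^ d_i` in a commutative group (in the
application `(ZMod p)ˣ`, `u_i` the residues of the generators `q_i`, `γ` a generator of
`G_p = ⟨u_i⟩`, witnessed by `γ = ∏ u_i ^ c_i`).  If the rows of the non-singular integer matrix
`V` are principal-unit rows, `∏_i u_i ^ (V j i) = 1`, and `h_j ≥ |V j i| · log 2`, then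
`(log 2)^n · orderOf γ ≤ n! · ∏_j h_j` — the order `|G_p|` of the residue group re-appears in
the product of the heights of ANY system of independent principal-unit generators. -/
theorem soloInformed_productCurrency_units {G : Type*} [CommGroup G] {n : ℕ} (u : Fin n → G)
    (γ : G) (d : Fin n → ℤ) (hd : ∀ i, u i = γ ^ d i)
    (hγ : ∃ c : Fin n → ℤ, γ = ∏ i, u i ^ c i)
    (V : Matrix (Fin n) (Fin n) ℤ) (hV : ∀ j, ∏ i, u i ^ V j i = 1) (hdet : V.det ≠ 0)
    (h : Fin n → ℝ) (hh : ∀ j i, (|V j i| : ℝ) * Real.log 2 ≤ h j) :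
    (Real.log 2) ^ n * (orderOf γ : ℝ) ≤ (n.factorial : ℝ) * ∏ j, h j :=
  soloInformed_productCurrency (orderOf γ) d
    (soloInformed_bezout_of_generator u γ d hd hγ) V
    (fun j => soloInformed_orderOf_dvd_row u γ d hd (fun i => V j i) (hV j)) hdet h hh

/-- THEOREM G, intrinsic form.  In a commutative CYCLIC group (e.g. `(ZMod p)ˣ`): if the rows of
the non-singular integer matrix `V` are relations `∏_i u_i ^ (V j i) = 1` and
`h_j ≥ |V j i| · log 2`, then `(log 2)^n · |⟨u_0, …, u_{n-1}⟩| ≤ n! · ∏_j h_j`.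
(The case `n = 2` of the index step is `soloInformed_card_closure_dvd_det` of
`SoloInformedRelationLattice.lean`, session 8.) -/
theorem soloInformed_productCurrency_closure {G : Type*} [CommGroup G] [IsCyclic G] {n : ℕ}
    (u : Fin n → G) (V : Matrix (Fin n) (Fin n) ℤ) (hV : ∀ j, ∏ i, u i ^ V j i = 1)
    (hdet : V.det ≠ 0) (h : Fin n → ℝ) (hh : ∀ j i, (|V j i| : ℝ) * Real.log 2 ≤ h j) :
    (Real.log 2) ^ n * (Nat.card (Subgroup.closure (Set.range u)) : ℝ) ≤
      (n.factorial : ℝ) * ∏ j, h j := by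
  set H := Subgroup.closure (Set.range u) with hH
  obtain ⟨γ, hγ⟩ := IsCyclic.exists_generator (α := H)
  have hN : orderOf (γ : G) = Nat.card H := by
    rw [Subgroup.orderOf_coe, orderOf_eq_card_of_forall_mem_zpowers hγ]
  -- discrete logarithms of the `u_i` to base `γ`
  have hd : ∀ i, ∃ d : ℤ, u i = (γ : G) ^ d := by
    intro i
    have hui : u i ∈ H := Subgroup.subset_closure (Set.mem_range_self i)
    obtain ⟨a, ha⟩ := Subgroup.mem_zpowers_iff.mp (hγ ⟨u i, hui⟩)
    have h2 : (γ : G) ^ a = u i := by simpa using congrArg Subtype.val ha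
    exact ⟨a, h2.symm⟩
  choose d hd using hd
  -- `γ ∈ ⟨u_i⟩` is a product of powers of the `u_i`
  obtain ⟨c, hc⟩ := Subgroup.exists_of_mem_closure_range u (γ : G) γ.2
  have := soloInformed_productCurrency_units u (γ : G) d hd ⟨c, hc⟩ V hV hdet h hh
  rw [hN] at this
  exact this

/-! ### The height hypothesis is the naive height of `η = ∏ q_i ^ v_i` -/

/-- For `q_i ≥ 2` and an exponent vector `v`, the naive numerator `∏ q_i ^ (v_i)⁺` and
denominator `∏ q_i ^ (v_i)⁻` of `η = ∏ q_i ^ v_i` satisfy `|v_i| · log 2 ≤ log max(num, den)`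
for every `i`: the hypothesis `hh` of Theorem G holds for the logarithmic height. -/
theorem soloInformed_log_two_mul_abs_le_log_max {n : ℕ} (q : Fin n → ℕ) (hq : ∀ i, 2 ≤ q i)
    (v : Fin n → ℤ) (i : Fin n) :
    (|v i| : ℝ) * Real.log 2 ≤
      Real.log (max (∏ k, (q k : ℝ) ^ (v k).toNat) (∏ k, (q k : ℝ) ^ (-v k).toNat)) := by
  rw [← Int.cast_abs, ← Nat.cast_natAbs]
  have hq0 : ∀ k, 0 < q k := fun k => by have := hq k; omega
  have hnum : ∀ (e : Fin n → ℕ), (2 : ℝ) ^ e i ≤ ∏ k, (q k : ℝ) ^ e k := by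
    intro e
    have hnat : 2 ^ e i ≤ ∏ k, q k ^ e k :=
      calc 2 ^ e i ≤ q i ^ e i := Nat.pow_le_pow_left (hq i) _
        _ ≤ ∏ k, q k ^ e k :=
            Nat.le_of_dvd (Finset.prod_pos fun k _ => pow_pos (hq0 k) _)
              (Finset.dvd_prod_of_mem (fun k => q k ^ e k) (Finset.mem_univ i))
    exact_mod_cast hnat
  rw [← Real.log_rpow two_pos, Real.rpow_natCast]
  apply Real.log_le_log (pow_pos two_pos _)
  rcases le_or_gt 0 (v i) with hv | hv
  · have : (v i).natAbs = (v i).toNat := by omega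
    rw [this]
    exact (hnum fun k => (v k).toNat).trans (le_max_left _ _)
  · have : (v i).natAbs = (-v i).toNat := by omega
    rw [this]
    exact (hnum fun k => (-v k).toNat).trans (le_max_right _ _)

/-- If the `q_i` are pairwise coprime, the naive numerator and denominator of `∏ q_i ^ v_i` are
coprime, so `log max(num, den)` is the logarithmic height of `η`. -/
theorem soloInformed_coprime_num_den {n : ℕ} (q : Fin n → ℕ)
    (hcop : ∀ i j, i ≠ j → Nat.Coprime (q i) (q j)) (v : Fin n → ℤ) :
    Nat.Coprime (∏ k, q k ^ (v k).toNat) (∏ k, q k ^ (-v k).toNat) := by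
  apply Nat.Coprime.prod_left
  intro i _
  apply Nat.Coprime.prod_right
  intro j _
  by_cases hij : i = j
  · subst hij
    rcases le_or_gt 0 (v i) with hv | hv
    · have : (-v i).toNat = 0 := by omega
      rw [this, pow_zero]
      exact Nat.coprime_one_right _
    · have : (v i).toNat = 0 := by omega
      rw [this, pow_zero]
      exact Nat.coprime_one_left _
  · exact Nat.Coprime.pow _ _ (hcop i j hij)

end Summit.ABC.ABC.Theorems
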